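import Mathlib.FieldTheory.Fixed
import Literature.NumberTheory.GaloisRepresentations.LocalGlobalSubfields
import Literature.NumberTheory.GaloisRepresentations.KummerLayerSetup
import HarnessLib

/-!
# The local class of the twisted norm and the completion of the descended cyclic layer

Topic `NumberTheory/GaloisRepresentations`; theorems only (no definition, no named fact).  This is
the local–global heart of Hecke's construction of a cyclic extension of prime degree `ℓ` of a
global field `k ⊆ K̄` (`k ⊇ K`, `K` a number field) whose completion at the place of `k` above `v`
defined by the chosen embedding `ι : K̄ → \bar K_v` is a prescribed cyclic extension `K'/k_v`.

Setting (as in `KummerLayerSetup`, at `K₀ = K_v`): `ζ` a primitive `ℓ`-th root of unity in `K̄`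
with image `ι ζ`, `Z ≤ Γ_{K_v}` its stabiliser, `H = {σ | σ fixes ι k} = Gal(\bar K_v/k_v)`,
`H' ≤ H` normal of index `ℓ` (`K' = \bar K_v^{H'}`), `W = H ⊓ Z = Gal(\bar K_v / k_v(ζ))`,
`W' = H' ⊓ Z`, `s ∈ W ∖ W'`, and `β ≠ 0` a Kummer generator of `K'(ζ)/k_v(ζ)` (`s β = ζ β`, `W'`
fixes `β`, `b = β ^ ℓ ∈ k_v(ζ)`).

* `mem_inf_iff_forall_smul_eq` — `W = {σ | σ fixes ι k(ζ)}`.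
* `exists_pow_mul_pow_eq_absClosureEmbedding_prod` — **the local class of the twisted norm**: for
  `a ∈ k(ζ)` with `ι a ∈ b · (k_v(ζ)^×)^ℓ` (C1) and `ι (γ a) ∈ (k_v(ζ)^×)^ℓ` for every `γ ∈ Gal(K̄/k)`
  moving the absolute value `|ι ·|_v` of `k(ζ)` (C2), the `ω`-twisted norm
  `A = ∏_σ σ(a)^{m_σ}` satisfies **`ι A = (β ^ d · Y) ^ ℓ` with `0 < d < ℓ` and `Y ≠ 0` fixed by `W`**:
  the conjugates `σ` preserving `|ι ·|_v` are induced by elements `h ∈ H`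
  (`exists_forall_smul_eq_of_forall_spectralNorm_eq`) and contribute `h(ι a)^{m_σ} ∈ b · (…)^ℓ` by
  the isotypy of the Kummer class (`apply_pow_eq_of_comm_of_kummer`, `m_σ χ(h) ≡ 1`), the others
  contribute `ℓ`-th powers; `d` is the number of the former, `1 ≤ d ≤ [k(ζ):k] < ℓ`.
* `eq_of_relIndex_dvd_of_inf_eq` — **the completion of the descended layer is `K'`**: a subgroup
  `X ≤ H` of index dividing `ℓ` with `X ⊓ W = W'` equals `H'` (Hall-type uniqueness in the abelian
  group `H/W'`).  With `X = Gal(\bar K_v / k_v M)` for the degree-`ℓ` subfield `M` of `k(ζ, A^{1/ℓ})`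
  cut out by Hecke's descent (`KummerEigenDescent`), `X ⊓ W = W'` is
  `apply_eq_iff_apply_eq_of_pow_eq` + `apply_eq_iff_mem_of_kummer`.

## References

* H. Cohen, *Advanced Topics in Computational Number Theory*, GTM 193, §10.2.3, Thm. 10.2.9;
  H. Cohen, P. Stevenhagen, *Computational class field theory*, in *Algorithmic Number Theory*,
  MSRI Publ. 44 (2008), §5, Case 2 (p. 532). [cite: BuhlerStevenhagen2008, §5 p. 532]
* J. Neukirch, *Algebraic Number Theory*, Ch. II (8.1)–(8.3), §9 (9.6). [NeukirchANT1999]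
-/

noncomputable section

open scoped NumberField IntermediateField
open Field IsDedekindDomain IntermediateField
open Literature.FieldTheory.Kummer

universe u

namespace Literature.NumberTheory.GaloisRepresentations

/-! ### The completion of the descended layer -/


section LocalConclusion

variable (K₀ : Type*) [Field K₀] {ℓ : ℕ} {ζ : AlgebraicClosure K₀}
variable {Z H H' X : Subgroup (absoluteGaloisGroup K₀)}

/-- **Hall-type uniqueness for the descended layer.**  In the setting of `KummerLayerSetup`
(`H' ≤ H` normal of prime index `ℓ`, `Z` the stabiliser of `ζ`), a subgroup `X ≤ H` whose index
divides `ℓ` and with `X ⊓ (H ⊓ Z) = H' ⊓ Z` is `H'`. [folklore] -/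
theorem eq_of_relIndex_dvd_of_inf_eq (hℓ : ℓ.Prime) (hζ : IsPrimitiveRoot ζ ℓ)
    (hZ : ∀ σ, σ ∈ Z ↔ σ • ζ = ζ) (hle : H' ≤ H)
    (hnorm : ∀ h ∈ H, ∀ h' ∈ H', h * h' * h⁻¹ ∈ H') (hidx : H'.relIndex H = ℓ)
    (hXH : X ≤ H) (hdvd : X.relIndex H ∣ ℓ) (hXW : X ⊓ (H ⊓ Z) = H' ⊓ Z) : X = H' := by
  obtain ⟨hidxW, hidxH'⟩ := relIndex_inf_eq_of_prime K₀ hℓ hζ hZ hle hnorm hidx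
  have hW'X : H' ⊓ Z ≤ X := hXW ▸ inf_le_left
  -- `[H : X] = ℓ`
  have hX : X.relIndex H = ℓ := by
    rcases (Nat.dvd_prime hℓ).1 hdvd with h1 | h1
    · exfalso
      have hHX : H ≤ X := Subgroup.relIndex_eq_one.1 h1
      have hXeq : X = H := le_antisymm hXH hHX
      rw [hXeq, ← inf_assoc, inf_idem] at hXW
      rw [← hXW, Subgroup.relIndex_self] at hidxW
      exact hℓ.one_lt.ne hidxW
    · exact h1
  -- `[X : W'] = [H : W]`
  have hXd : (H' ⊓ Z).relIndex X = Z.relIndex H := by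
    have h1 := Subgroup.relIndex_mul_relIndex (H' ⊓ Z) X H hW'X hXH
    rw [hX, ← Subgroup.relIndex_mul_relIndex (H' ⊓ Z) H' H inf_le_left hle, hidx, hidxH'] at h1
    exact Nat.eq_of_mul_eq_mul_right hℓ.pos h1
  exact eq_of_relIndex_eq_prime_of_commutator_le hXH hle hW'X inf_le_left
    (fun a ha b hb => commutator_mem_inf K₀ hℓ hζ hZ hle hnorm hidx ha hb) hℓ
    (not_dvd_relIndex K₀ hℓ hζ hZ H) hX hidx hXd hidxH'

end LocalConclusion

/-! ### The local class of the twisted norm -/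

section ClassIdentity

variable (K : Type u) [Field K] [NumberField K] (v : HeightOneSpectrum (𝓞 K))

/-- `W = H ⊓ Z` fixes `ι k(ζ)` pointwise (and conversely): with `H = {σ | σ fixes ι k}` and `Z`
the stabiliser of `ι ζ`. [folklore] -/
theorem mem_inf_iff_forall_smul_eq (k : IntermediateField K (AlgebraicClosure K))
    {ζg : AlgebraicClosure K}
    {Z H : Subgroup (absoluteGaloisGroup (v.adicCompletion K))}
    (hZ : ∀ σ, σ ∈ Z ↔ σ • absClosureEmbedding K (v.adicCompletion K) ζg =
      absClosureEmbedding K (v.adicCompletion K) ζg)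
    (hH : ∀ σ, σ ∈ H ↔ ∀ x ∈ k, σ • absClosureEmbedding K (v.adicCompletion K) x =
      absClosureEmbedding K (v.adicCompletion K) x)
    (σ : absoluteGaloisGroup (v.adicCompletion K)) :
    σ ∈ H ⊓ Z ↔ ∀ x ∈ (↥k)⟮ζg⟯, σ • absClosureEmbedding K (v.adicCompletion K) x =
      absClosureEmbedding K (v.adicCompletion K) x := by
  constructor
  · intro hσ x hx
    have hσH := (hH σ).1 hσ.1
    have hσZ := (hZ σ).1 hσ.2
    induction hx using IntermediateField.adjoin_induction with
    | mem y hy =>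
        rw [Set.mem_singleton_iff] at hy
        rw [hy]; exact hσZ
    | algebraMap c => exact hσH c c.2
    | add x y _ _ hx hy => rw [map_add, smul_add, hx, hy]
    | inv x _ hx => rw [map_inv₀, smul_inv'', hx]
    | mul x y _ _ hx hy => rw [map_mul, smul_mul', hx, hy]
  · intro h
    refine ⟨(hH σ).2 fun x hx => h x ?_, (hZ σ).2 (h ζg (mem_adjoin_simple_self _ ζg))⟩
    exact (IntermediateField.algebraMap_mem (↥k)⟮ζg⟯ (⟨x, hx⟩ : k))

/-- **The local class of the `ω`-twisted norm.**  Notation of the module docstring; `a ∈ k(ζ)`,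
`a ≠ 0`, `m_σ` with `m_σ n ≡ 1 (mod ℓ)` whenever `σ ζ = ζⁿ`, `A = ∏_σ σ(a)^{m_σ}`.  Assume
(C1) `ι a = b · y^ℓ` with `y ≠ 0` fixed by `W`, and (C2) for every `γ ∈ Gal(K̄/k)` that does not
preserve the absolute value `|ι ·|_v` on `k(ζ)`, `ι (γ a)` is the `ℓ`-th power of a `W`-fixed
element.  Then `ι A = (β ^ d · Y) ^ ℓ` for some `0 < d < ℓ` and some `Y ≠ 0` fixed by `W`.
Cohen–Stevenhagen, *Computational class field theory*, §5, Case 2; Cohen, *Advanced Topics*,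
Thm. 10.2.9. [cite: BuhlerStevenhagen2008, §5 p. 532] -/
theorem exists_pow_mul_pow_eq_absClosureEmbedding_prod
    (k : IntermediateField K (AlgebraicClosure K)) {ℓ : ℕ} (hℓ : ℓ.Prime)
    {ζg : AlgebraicClosure K} (hζg : IsPrimitiveRoot ζg ℓ)
    (hnormal : Normal K (IntermediateField.restrictScalars K (↥k)⟮ζg⟯))
    [FiniteDimensional (↥k) (↥k)⟮ζg⟯]
    {a : AlgebraicClosure K} (ha : a ∈ (↥k)⟮ζg⟯) (ha0 : a ≠ 0)
    (m : ((↥k)⟮ζg⟯ ≃ₐ[↥k] (↥k)⟮ζg⟯) → ℕ)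
    (hm : ∀ (σ : (↥k)⟮ζg⟯ ≃ₐ[↥k] (↥k)⟮ζg⟯) (n : ℕ),
      (σ ⟨ζg, mem_adjoin_simple_self _ ζg⟩ : AlgebraicClosure K) = ζg ^ n → m σ * n ≡ 1 [MOD ℓ])
    {Z H H' : Subgroup (absoluteGaloisGroup (v.adicCompletion K))}
    (hZ : ∀ σ, σ ∈ Z ↔ σ • absClosureEmbedding K (v.adicCompletion K) ζg =
      absClosureEmbedding K (v.adicCompletion K) ζg)
    (hH : ∀ σ, σ ∈ H ↔ ∀ x ∈ k, σ • absClosureEmbedding K (v.adicCompletion K) x =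
      absClosureEmbedding K (v.adicCompletion K) x)
    (hle : H' ≤ H) (hnorm : ∀ h ∈ H, ∀ h' ∈ H', h * h' * h⁻¹ ∈ H') (hidx : H'.relIndex H = ℓ)
    {s : absoluteGaloisGroup (v.adicCompletion K)} (hs : s ∈ H ⊓ Z) (hs' : s ∉ H' ⊓ Z)
    {β : AlgebraicClosure (v.adicCompletion K)} (hβ0 : β ≠ 0) (hβW' : ∀ w ∈ H' ⊓ Z, w • β = β)
    (hsβ : s • β = absClosureEmbedding K (v.adicCompletion K) ζg * β)
    (hC1 : ∃ y : AlgebraicClosure (v.adicCompletion K), y ≠ 0 ∧ (∀ w ∈ H ⊓ Z, w • y = y) ∧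
      absClosureEmbedding K (v.adicCompletion K) a = β ^ ℓ * y ^ ℓ)
    (hC2 : ∀ γ : absoluteGaloisGroup K, (∀ x ∈ k, γ • x = x) →
      (∃ x ∈ (↥k)⟮ζg⟯,
        spectralNorm (v.adicCompletion K) (AlgebraicClosure (v.adicCompletion K))
            (absClosureEmbedding K (v.adicCompletion K) (γ • x)) ≠
          spectralNorm (v.adicCompletion K) (AlgebraicClosure (v.adicCompletion K))
            (absClosureEmbedding K (v.adicCompletion K) x)) →
      ∃ y : AlgebraicClosure (v.adicCompletion K), (∀ w ∈ H ⊓ Z, w • y = y) ∧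
        absClosureEmbedding K (v.adicCompletion K) (γ • a) = y ^ ℓ) :
    ∃ (d : ℕ) (Y : AlgebraicClosure (v.adicCompletion K)), 0 < d ∧ d < ℓ ∧ Y ≠ 0 ∧
      (∀ w ∈ H ⊓ Z, w • Y = Y) ∧
      absClosureEmbedding K (v.adicCompletion K)
        (∏ σ : (↥k)⟮ζg⟯ ≃ₐ[↥k] (↥k)⟮ζg⟯, (σ ⟨a, ha⟩ : AlgebraicClosure K) ^ m σ) =
        (β ^ d * Y) ^ ℓ := by
  classical
  haveI : NeZero ℓ := ⟨hℓ.ne_zero⟩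
  haveI hnK : Normal (↥k) (AlgebraicClosure K) :=
    Normal.tower_top_of_normal K (↥k) (AlgebraicClosure K)
  haveI := hnormal
  have hζ : IsPrimitiveRoot (absClosureEmbedding K (v.adicCompletion K) ζg) ℓ :=
    hζg.map_of_injective (absClosureEmbedding K (v.adicCompletion K)).injective
  -- `W = H ⊓ Z`: basic facts
  have hW'W : H' ⊓ Z ≤ H ⊓ Z := inf_le_inf_right Z hle
  have hζW : ∀ w ∈ H ⊓ Z, w • absClosureEmbedding K (v.adicCompletion K) ζg =
      absClosureEmbedding K (v.adicCompletion K) ζg := fun w hw => (hZ w).1 hw.2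
  have hnormW : ∀ w ∈ H ⊓ Z, ∀ w' ∈ H' ⊓ Z, w * w' * w⁻¹ ∈ H' ⊓ Z := fun w hw w' hw' =>
    conj_mem_inf_of_mem_inf (v.adicCompletion K) hℓ hζ hZ hnorm hw hw'
  have hidxW := (relIndex_inf_eq_of_prime (v.adicCompletion K) hℓ hζ hZ hle hnorm hidx).1
  -- `b = β ^ ℓ` is `W`-fixed
  have hbW : ∀ w ∈ H ⊓ Z, w • β ^ ℓ = β ^ ℓ := fun w hw =>
    (apply_pow_eq_of_kummer (K₀ := v.adicCompletion K)
      (Ω := AlgebraicClosure (v.adicCompletion K)) hℓ hζ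
      (W := (H ⊓ Z : Subgroup (AlgebraicClosure (v.adicCompletion K) ≃ₐ[v.adicCompletion K]
        AlgebraicClosure (v.adicCompletion K))))
      (W' := (H' ⊓ Z : Subgroup (AlgebraicClosure (v.adicCompletion K) ≃ₐ[v.adicCompletion K]
        AlgebraicClosure (v.adicCompletion K)))) hW'W hnormW hidxW
      (s := absoluteGaloisGroup.toAlgEquiv (v.adicCompletion K) s) hs hs' hζW hβW' hsβ
      (w := absoluteGaloisGroup.toAlgEquiv (v.adicCompletion K) w) hw).2
  -- `W`-fixedness is transported by `h ∈ H`
  have hHfix : ∀ h ∈ H, ∀ y : AlgebraicClosure (v.adicCompletion K), (∀ w ∈ H ⊓ Z, w • y = y) →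
      ∀ w ∈ H ⊓ Z, w • h • y = h • y := by
    intro h hh y hy w hw
    have h1 : h • ((h⁻¹ * w * h) • y) = w • h • y := by
      rw [← mul_smul, ← mul_smul]
      congr 1
      group
    rw [← h1, hy _ (inv_mul_mul_mem_inf (v.adicCompletion K) hℓ hζ hZ hh hw)]
  -- lifts of the automorphisms of `k(ζ)/k` to `Γ_K`
  have hlift : ∀ σ : (↥k)⟮ζg⟯ ≃ₐ[↥k] (↥k)⟮ζg⟯, ∃ γ : absoluteGaloisGroup K,
      (∀ x ∈ k, γ • x = x) ∧
        ∀ y : (↥k)⟮ζg⟯, γ • (y : AlgebraicClosure K) = (σ y : AlgebraicClosure K) := by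
    intro σ
    refine ⟨(absoluteGaloisGroup.toAlgEquiv K).symm
      ((σ.liftNormal (AlgebraicClosure K)).restrictScalars K), fun x hx => ?_, fun y => ?_⟩
    · change (σ.liftNormal (AlgebraicClosure K)) x = x
      exact (σ.liftNormal (AlgebraicClosure K)).commutes (⟨x, hx⟩ : k)
    · change (σ.liftNormal (AlgebraicClosure K)) (y : AlgebraicClosure K) =
        (σ y : AlgebraicClosure K)
      exact σ.liftNormal_commutes (AlgebraicClosure K) y
  choose γ hγk hγσ using hlift
  obtain ⟨y, hy0, hyW, hay⟩ := hC1
  -- the predicate "`σ` preserves `|ι ·|_v` on `k(ζ)`"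
  let P : ((↥k)⟮ζg⟯ ≃ₐ[↥k] (↥k)⟮ζg⟯) → Prop := fun σ => ∀ x ∈ (↥k)⟮ζg⟯,
    spectralNorm (v.adicCompletion K) (AlgebraicClosure (v.adicCompletion K))
        (absClosureEmbedding K (v.adicCompletion K) (γ σ • x)) =
      spectralNorm (v.adicCompletion K) (AlgebraicClosure (v.adicCompletion K))
        (absClosureEmbedding K (v.adicCompletion K) x)
  -- the factor of `σ` in `ι A`
  have hfactor : ∀ σ : (↥k)⟮ζg⟯ ≃ₐ[↥k] (↥k)⟮ζg⟯, ∃ E : AlgebraicClosure (v.adicCompletion K),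
      (∀ w ∈ H ⊓ Z, w • E = E) ∧
      absClosureEmbedding K (v.adicCompletion K)
          ((σ ⟨a, ha⟩ : (↥k)⟮ζg⟯) : AlgebraicClosure K) ^ m σ =
        (β ^ ℓ) ^ (if P σ then 1 else 0) * E ^ ℓ := by
    intro σ
    have hσa : ((σ ⟨a, ha⟩ : (↥k)⟮ζg⟯) : AlgebraicClosure K) = γ σ • a := (hγσ σ ⟨a, ha⟩).symm
    by_cases hP : P σ
    · -- `σ` preserves `|ι ·|_v`: it is induced by some `h ∈ H`
      rw [if_pos hP]
      obtain ⟨h, hh⟩ := exists_forall_smul_eq_of_forall_spectralNorm_eq K v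
        (IntermediateField.restrictScalars K (↥k)⟮ζg⟯) (γ σ) (fun x hx => hP x hx)
      have hhH : h ∈ H := (hH h).2 fun x hx => by
        rw [← hh x (IntermediateField.algebraMap_mem (↥k)⟮ζg⟯ (⟨x, hx⟩ : k)), hγk σ x hx]
      obtain ⟨n, hn⟩ := exists_smul_eq_pow (v.adicCompletion K) hℓ hζ h
      have hσζ : ((σ ⟨ζg, mem_adjoin_simple_self _ ζg⟩ : (↥k)⟮ζg⟯) : AlgebraicClosure K) =
          ζg ^ n := by
        have h1 : absClosureEmbedding K (v.adicCompletion K)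
            ((σ ⟨ζg, mem_adjoin_simple_self _ ζg⟩ : (↥k)⟮ζg⟯) : AlgebraicClosure K) =
            absClosureEmbedding K (v.adicCompletion K) (ζg ^ n) := by
          rw [← hγσ]
          change absClosureEmbedding K (v.adicCompletion K) (γ σ • ζg) = _
          rw [hh _ (mem_adjoin_simple_self _ ζg), hn, map_pow]
        exact (absClosureEmbedding K (v.adicCompletion K)).injective h1
      have hmn : m σ * n ≡ 1 [MOD ℓ] := hm σ n hσζ
      -- isotypy of `b` under `h`
      have hcomm : s⁻¹ * h⁻¹ * s * h ∈ H' ⊓ Z := by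
        simpa using commutator_mem_inf (v.adicCompletion K) hℓ hζ hZ hle hnorm hidx
          (Subgroup.inv_mem _ hs.1) (H.inv_mem hhH)
      obtain ⟨j, -, hjn, e, heW, hiso⟩ := apply_pow_eq_of_comm_of_kummer
        (K₀ := v.adicCompletion K) (Ω := AlgebraicClosure (v.adicCompletion K)) hℓ hζ
        (W := (H ⊓ Z : Subgroup (AlgebraicClosure (v.adicCompletion K) ≃ₐ[v.adicCompletion K]
          AlgebraicClosure (v.adicCompletion K))))
        (W' := (H' ⊓ Z : Subgroup (AlgebraicClosure (v.adicCompletion K) ≃ₐ[v.adicCompletion K]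
          AlgebraicClosure (v.adicCompletion K)))) hW'W hnormW hidxW
        (s := absoluteGaloisGroup.toAlgEquiv (v.adicCompletion K) s) hs hs' hζW hβ0 hβW' hsβ
        (σ := absoluteGaloisGroup.toAlgEquiv (v.adicCompletion K) h)
        (fun w hw => inv_mul_mul_mem_inf (v.adicCompletion K) hℓ hζ hZ hhH hw)
        (fun w hw => inv_mul_mul_mem_inf' (v.adicCompletion K) hℓ hζ hZ hnorm hhH hw) hcomm hn
      have hiso' : h • β ^ ℓ = (β ^ ℓ) ^ j * e ^ ℓ := hiso
      have heW' : ∀ w ∈ H ⊓ Z, w • e = e := heW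
      -- `j m ≡ n m ≡ 1 (mod ℓ)`
      have hjm : j * m σ % ℓ = 1 := by
        have h1 : j * m σ ≡ 1 [MOD ℓ] :=
          (hjn.mul_right (m σ)).trans (by rw [mul_comm]; exact hmn)
        have h2 : (1 : ℕ) % ℓ = 1 := Nat.mod_eq_of_lt hℓ.one_lt
        unfold Nat.ModEq at h1
        rw [h2] at h1
        exact h1
      have hdecomp : j * m σ = ℓ * (j * m σ / ℓ) + 1 := by
        have := Nat.div_add_mod (j * m σ) ℓ
        rw [hjm] at this
        exact this.symm
      refine ⟨(β ^ ℓ) ^ (j * m σ / ℓ) * (e * h • y) ^ m σ, fun w hw => ?_, ?_⟩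
      · rw [smul_mul', smul_pow' w (β ^ ℓ) (j * m σ / ℓ), hbW w hw, smul_pow' w (e * h • y) (m σ),
          smul_mul', heW' w hw, hHfix h hhH y hyW w hw]
      · rw [hσa, hh a ha, hay, smul_mul', hiso', smul_pow']
        calc ((β ^ ℓ) ^ j * e ^ ℓ * (h • y) ^ ℓ) ^ m σ
            = (β ^ ℓ) ^ (j * m σ) * (e * h • y) ^ (ℓ * m σ) := by ring
          _ = (β ^ ℓ) ^ (ℓ * (j * m σ / ℓ) + 1) * (e * h • y) ^ (ℓ * m σ) := by rw [← hdecomp]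
          _ = (β ^ ℓ) ^ 1 * ((β ^ ℓ) ^ (j * m σ / ℓ) * (e * h • y) ^ m σ) ^ ℓ := by ring
    · -- `σ` moves `|ι ·|_v`: `ι (γ a)` is an `ℓ`-th power
      rw [if_neg hP]
      have hP' : ∃ x ∈ (↥k)⟮ζg⟯,
          spectralNorm (v.adicCompletion K) (AlgebraicClosure (v.adicCompletion K))
              (absClosureEmbedding K (v.adicCompletion K) (γ σ • x)) ≠
            spectralNorm (v.adicCompletion K) (AlgebraicClosure (v.adicCompletion K))
              (absClosureEmbedding K (v.adicCompletion K) x) := by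
        by_contra hcon
        apply hP
        intro x hx
        by_contra hne
        exact hcon ⟨x, hx, hne⟩
      obtain ⟨y', hy'W, hy'⟩ := hC2 (γ σ) (hγk σ) hP'
      refine ⟨y' ^ m σ, fun w hw => by rw [smul_pow', hy'W w hw], ?_⟩
      rw [hσa, hy', pow_zero, one_mul, ← pow_mul, mul_comm, pow_mul]
  choose E hEW hEeq using hfactor
  refine ⟨∑ σ, (if P σ then 1 else 0), ∏ σ, E σ, ?_, ?_, ?_, ?_, ?_⟩
  · -- `0 < d`: the identity preserves `|ι ·|_v`
    have hP1 : P 1 := fun x hx => by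
      have h1 : γ 1 • x = x := by
        have := hγσ 1 ⟨x, hx⟩
        rwa [AlgEquiv.one_apply] at this
      rw [h1]
    calc 0 < (if P 1 then 1 else 0) := by rw [if_pos hP1]; exact one_pos
      _ ≤ ∑ σ, (if P σ then 1 else 0) :=
          Finset.single_le_sum (f := fun σ => if P σ then 1 else 0) (fun σ _ => Nat.zero_le _)
            (Finset.mem_univ _)
  · -- `d < ℓ`: `d ≤ #Gal(k(ζ)/k) ≤ [k(ζ):k] < ℓ`
    calc ∑ σ, (if P σ then 1 else 0)
        ≤ ∑ _σ : (↥k)⟮ζg⟯ ≃ₐ[↥k] (↥k)⟮ζg⟯, 1 :=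
          Finset.sum_le_sum fun σ _ => by split_ifs <;> omega
      _ = Fintype.card ((↥k)⟮ζg⟯ ≃ₐ[↥k] (↥k)⟮ζg⟯) := by simp
      _ ≤ Module.finrank (↥k) (↥k)⟮ζg⟯ := AlgEquiv.card_le
      _ < ℓ := finrank_adjoin_zeta_lt hℓ hζg
  · -- `Y ≠ 0`
    rw [Finset.prod_ne_zero_iff]
    intro σ _ hE0
    have h1 := hEeq σ
    rw [hE0, zero_pow hℓ.ne_zero, mul_zero] at h1
    have h2 : absClosureEmbedding K (v.adicCompletion K)
        ((σ ⟨a, ha⟩ : (↥k)⟮ζg⟯) : AlgebraicClosure K) ≠ 0 := by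
      rw [Ne, map_eq_zero, ZeroMemClass.coe_eq_zero, map_eq_zero]
      exact fun h0 => ha0 (congrArg Subtype.val h0)
    exact pow_ne_zero _ h2 h1
  · -- `W`-fixed
    intro w hw
    rw [Finset.smul_prod']
    exact Finset.prod_congr rfl fun σ _ => hEW σ w hw
  · -- the identity
    rw [map_prod]
    simp_rw [map_pow]
    rw [Finset.prod_congr rfl fun σ _ => hEeq σ, Finset.prod_mul_distrib, Finset.prod_pow_eq_pow_sum,
      Finset.prod_pow]
    ring

end ClassIdentity

end Literature.NumberTheory.GaloisRepresentations
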